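/-
Copyright (c) 2026 the pub-hodgecm-mathlib formalisation cell (harness21).  Prover seat hodgecm-mathlib-K2Liu-p10 (g0), Track B «K2-LIT»,
#184♮ = hLiu418 = `stmt-HodgeConjecture-24832`; LEAD F0P6-plan (g11) RE-POINT 2026-09-04T05:28:07Z of req649 (S3) + GO 05:35:04Z: #33b (D2),
the generic «uniform local constancy» lemma — a left-`(P, δ)`-equivariant locally constant function supported on `P·C`, `C` compact, over a
topological group with a basis of open subgroups at `1`, is right-invariant under SOME open subgroup.
-/
import Mathlib.Topology.Algebra.OpenSubgroup
import Mathlib.Topology.LocallyConstant.Basic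
import HarnessLib

/-!
# Crux `HLiu418`, road `K2_Liu`, socket #33b organ (D2): an equivariant locally constant function with compact support modulo `P`
# is right-invariant under an open subgroup

Cell `hodgecm-mathlib`, crux item hLiu418 = `stmt-HodgeConjecture-24832`; squad K2, LEAD F0P6-plan (g11) (ruling «M-155n» (3) (D2), GO 2026-09-04T05:35:04Z),
box K2E5-r01 (g6), consumer K2E2-p12 (g3) (#33b (D-fin): the local Siegel section `φ_v := δ_v ⊗ g_v` on the main orbit `Ω_v = P_{Δ,v}·ι_v(G_v × 1)` at a finite
place `v ∈ S` is right-`K′_v`-invariant for SOME open `K′_v ≤ H_v` — the `∃ K'` conjunct of WORDS-33b).  THEOREMS ONLY (Mathlib only; no `def`, no instance,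
no notation, no named-fact hypothesis, no `sorry`); lane `--supports stmt-HodgeConjecture-24832 --as helper` (count-neutral helper).

THE LEMMA (`exists_isOpen_subgroup_mul_right_invariant`).  Let `H` be a topological group in which every neighbourhood of `1` contains an OPEN SUBGROUP
(hypothesis `hK`, BY VALUE — e.g. `H = H(L⁺_v)` a `v`-adic group with its congruence subgroups; compactness of the subgroups is not needed), `P ≤ H` any
subgroup, `δ, φ : H → A` (`A` with `*` and `0`) with `φ(p·h) = δ(p)·φ(h)` for `p ∈ P` (left equivariance), `φ` LOCALLY CONSTANT on `H`, and `φ = 0` off `P·C`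
for a COMPACT `C ⊆ H`.  Then there is an OPEN SUBGROUP `K′ ≤ H` with `φ(h·k) = φ(h)` for all `h ∈ H`, `k ∈ K′`.
PROOF.  For `c ∈ H` the fibre `W_c = φ⁻¹{φ c}` is open; `V_c := {v | c·v ∈ W_c}` is an open neighbourhood of `1`; pick an open `U_c ∋ 1` with `U_c·U_c ⊆ V_c`.
The open sets `c·U_c` cover `C`; take a finite subcover `c₁·U₁, …, c_m·U_m` and an open subgroup `K′ ⊆ ⋂ Uᵢ` (`hK`).  If `c ∈ C`, `c ∈ cᵢ·Uᵢ`, and `k ∈ K′`,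
then `cᵢ⁻¹·c·k ∈ Uᵢ·Uᵢ ⊆ Vᵢ` and `cᵢ⁻¹·c = cᵢ⁻¹·c·1 ∈ Vᵢ`, so `φ(c·k) = φ(cᵢ) = φ(c)`; hence `φ(p·c·k) = δ(p)·φ(c·k) = δ(p)·φ(c) = φ(p·c)` on `P·C`;
off `P·C`, if `h·k ∈ P·C` then `φ(h) = φ(h·k·k⁻¹) = φ(h·k)` by the first case (`k⁻¹ ∈ K′`), else both vanish.  Non-vacuous at `C = ∅` ∕ `φ = 0`.
(At the archimedean place `hK` fails — a Lie group has no small subgroups — and is not needed: WORDS-33b asks right-invariance only for `k` with `k_∞ = 1`.)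
[cite: BorelJacquet1979, §4.1 (smooth vectors of admissible representations of totally disconnected groups: uniform local constancy)]
[cite: GelbartPiatetskishapiroRallis1987, Part A §1 (sections of `Ind_P^H δ` supported on the main orbit)] [cite: Liu2011, §2C p. 863].
HONEST LABEL.  Count-neutral helper; `HC_CM` is proved only modulo the 7 printed citations (2 remaining named inputs: hLiu418 = `stmt-HodgeConjecture-24832`,
h413 = `stmt-HodgeConjecture-24833`) until rung 0 closes.
-/

set_option autoImplicit false
set_option linter.dupNamespace false -- the mandated namespace repeats `HodgeConjecture.HodgeConjecture`

namespace Summit.HodgeConjecture.HodgeConjecture.Cruxes.HLiu418.K2LiuEquivariantLocallyConstantOpenStabilizer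

open Topology Filter Set
open scoped Pointwise

variable {H : Type*} [Group H] [TopologicalSpace H] [IsTopologicalGroup H] {A : Type*}

/-- **Local constancy along a compact set is uniform**: for `φ` locally constant on a topological group `H` with a basis of open subgroups at `1` and
`C ⊆ H` compact, there is an open subgroup `K′` with `φ(c·k) = φ(c)` for all `c ∈ C`, `k ∈ K′`. [cite: BorelJacquet1979, §4.1] -/
theorem exists_isOpen_subgroup_apply_mul_eq_of_isCompact
    (hK : ∀ U ∈ 𝓝 (1 : H), ∃ K : Subgroup H, IsOpen (K : Set H) ∧ (K : Set H) ⊆ U)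
    (φ : H → A) (hloc : IsLocallyConstant φ) {C : Set H} (hC : IsCompact C) :
    ∃ K' : Subgroup H, IsOpen (K' : Set H) ∧ ∀ c ∈ C, ∀ k ∈ K', φ (c * k) = φ c := by
  -- `V c = {v | φ (c v) = φ c}` is an open neighbourhood of `1`; `U c` open with `1 ∈ U c`, `U c * U c ⊆ V c`
  have hV : ∀ c : H, ∃ U : Set H, IsOpen U ∧ (1 : H) ∈ U ∧ U * U ⊆ {v | φ (c * v) = φ c} := fun c =>
    exists_open_nhds_one_mul_subset
      (((hloc.isOpen_fiber (φ c)).preimage (continuous_const.mul continuous_id)).mem_nhds (by simp))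
  choose U hUo hU1 hUU using hV
  -- the open cover `c ↦ c · U c` of `C` and a finite subcover
  have hcover : C ⊆ ⋃ c : H, (fun x => c⁻¹ * x) ⁻¹' U c := fun x _ =>
    Set.mem_iUnion.2 ⟨x, by simpa using hU1 x⟩
  obtain ⟨t, ht⟩ := hC.elim_finite_subcover (fun c : H => (fun x => c⁻¹ * x) ⁻¹' U c)
    (fun c => (hUo c).preimage (continuous_const.mul continuous_id)) hcover
  -- an open subgroup inside `⋂_{c ∈ t} U c`
  obtain ⟨K', hK'o, hK'V⟩ := hK (⋂ c ∈ t, U c)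
    ((isOpen_biInter_finset fun c _ => hUo c).mem_nhds (Set.mem_iInter₂.2 fun c _ => hU1 c))
  refine ⟨K', hK'o, fun c hc k hk => ?_⟩
  obtain ⟨i, hi, hci⟩ := Set.mem_iUnion₂.1 (ht hc)
  have hk' : k ∈ U i := Set.mem_iInter₂.1 (hK'V hk) i hi
  have hci' : i⁻¹ * c ∈ U i := hci
  -- `φ (c k) = φ i` and `φ c = φ i`
  have h1 : φ (i * (i⁻¹ * c * k)) = φ i := hUU i (Set.mul_mem_mul hci' hk')
  have h2 : φ (i * (i⁻¹ * c * 1)) = φ i := hUU i (Set.mul_mem_mul hci' (hU1 i))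
  rw [mul_one, mul_inv_cancel_left] at h2
  rw [mul_assoc, mul_inv_cancel_left] at h1
  rw [h1, h2]

/-- **(D2) AN EQUIVARIANT LOCALLY CONSTANT FUNCTION WITH COMPACT SUPPORT MODULO `P` IS RIGHT-INVARIANT UNDER AN OPEN SUBGROUP.**
`H` a topological group with a basis of open subgroups at `1` (`hK`, by value), `P ≤ H`, `φ(p·h) = δ(p)·φ(h)` (`p ∈ P`), `φ` locally constant,
`φ = 0` off `P·C` with `C` compact ⟹ `∃ K′` open subgroup, `φ(h·k) = φ(h)` for all `h`, all `k ∈ K′`.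
[cite: BorelJacquet1979, §4.1] [cite: GelbartPiatetskishapiroRallis1987, Part A §1] [cite: Liu2011, §2C p. 863] -/
theorem exists_isOpen_subgroup_mul_right_invariant [Mul A] [Zero A]
    (hK : ∀ U ∈ 𝓝 (1 : H), ∃ K : Subgroup H, IsOpen (K : Set H) ∧ (K : Set H) ⊆ U)
    (P : Subgroup H) (δ φ : H → A) (hφ : ∀ p ∈ P, ∀ h, φ (p * h) = δ p * φ h)
    (hloc : IsLocallyConstant φ) {C : Set H} (hC : IsCompact C) (hsupp : ∀ h, h ∉ (P : Set H) * C → φ h = 0) :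
    ∃ K' : Subgroup H, IsOpen (K' : Set H) ∧ ∀ h, ∀ k ∈ K', φ (h * k) = φ h := by
  obtain ⟨K', hK'o, hK'C⟩ := exists_isOpen_subgroup_apply_mul_eq_of_isCompact hK φ hloc hC
  -- on `P · C`
  have key : ∀ h ∈ (P : Set H) * C, ∀ k ∈ K', φ (h * k) = φ h := by
    intro h hh k hk
    obtain ⟨p, hp, c, hc, rfl⟩ := Set.mem_mul.1 hh
    rw [mul_assoc, hφ p hp, hφ p hp, hK'C c hc k hk]
  refine ⟨K', hK'o, fun h k hk => ?_⟩
  by_cases hh : h ∈ (P : Set H) * C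
  · exact key h hh k hk
  · by_cases hhk : h * k ∈ (P : Set H) * C
    · have h' := key (h * k) hhk k⁻¹ (K'.inv_mem hk)
      rw [mul_inv_cancel_right] at h'
      exact h'.symm
    · rw [hsupp _ hhk, hsupp _ hh]

end Summit.HodgeConjecture.HodgeConjecture.Cruxes.HLiu418.K2LiuEquivariantLocallyConstantOpenStabilizer
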